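import Summits.CriticalPhenomena.PercolationContinuityZ3.Theorems.PercNearOneGluingNoHeavyLowerTailKNGoodTwoMarkCells
import HarnessLib

/-!
# `NoHeavyLowerTail` (stmt-CriticalPhenomena-4575) — from the two-mark inequality (II) to Kozma–Nitzan's box:
# the cluster-domination endpoint (prim-hp-2 gen 28, MEMO-gen26 §2 / MEMO-gen28 §5; part 4)

Support file (`--supports stmt-CriticalPhenomena-4575`, hull-port prover `prim-hp-2`, gen 28).  No definitions, no
named facts, no sorries; standard axioms.

Setting (MEMO-gen26 §1–2): one finite weighted graph (think `G − b`), an observer `o`, a loser `c` and two competitors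
`a, t`.  Kozma–Nitzan's pre-FKG inequality (3) at `|A| = 3` for EVERY graph follows ("b-revelation") from the cluster
domination GF(2): `μ_o := Law(C_o ; o ↔ {a,t}, c ∉ C_o) ≽ λ_a·Law(C_a ; c ∉ C_a) + λ_t·Law(C_t ; c ∉ C_t)` for one point
`(λ_a, λ_t)` of the box `λ_a ≥ κ_a := μ(o ∈ C_a | a ↮ t, a ↮ c)`, `λ_t ≥ κ_t`, `λ_a μ(a↮c) + λ_t μ(t↮c) = μ(o ↔ {a,t}, o ↮ c)`.
THIS FILE proves the bookkeeping of the box ENDPOINT `λ_a = κ_a`: for every up-family `𝒰` of vertex sets,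

  BHK (source `{a}`, sinks `{t,c}`)  +  (II) for `(s, x, o, a) := (t, c, o, a)` and `E = {C_t ∈ 𝒰}`
      ⟹  `μ_o(𝒰) ≥ κ_a·ν_a(𝒰) + λ_t·ν_t(𝒰)`,  `λ_t = [μ(t~o, t↮c) − κ_a μ(t~a, t↮c)] / μ(t↮c)`   (denominator-free),

* `KNGoodTwoMark.dominance_endpoint_of_tilt` — the bridge, with (II) (in the exact denominator-free shape of
  `filter_tilt` / `cov_tilt_of_no_sinkpath`, constant `κ_a`) as a HYPOTHESIS;
* `KNGoodTwoMark.tilt_weaken` — (II) with a larger constant implies (II) with a smaller one (`Cov_Q(A,E) ≥ 0`, BHK);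
* (part 5, `…KNGoodTwoMarkDominanceCases.lean`): the UNCONDITIONAL corollaries for up-families inside `{a ∈ W}`
  (from `filter_tilt`) and for all up-families when `μ(a~c, t↮c) = 0` (from `cov_tilt_of_no_sinkpath`).
So GF(2) at the box endpoint — hence KN (3) at `|A| = 3` once the b-revelation is formalised — is reduced inside the tree
to the single inequality (II) of MEMO-gen26 §3.
[cite: VandenbergHaggstromKahn2005, Thms. 1.1–1.5 (pp. 3–8)] [cite: KozmaNitzan2024, §2.2 Lemmas 1–2 (pp. 5–6), §3 (pp. 7–12)]
-/

noncomputable section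

namespace Summit.CriticalPhenomena.PercolationContinuityZ3.Theorems

open MeasureTheory Set Literature.Probability.LatticeModels Literature.Probability.Percolation
open scoped Classical

namespace KNGoodTwoMark

variable {V : Type*}

/-- `{C_o ∈ 𝒰} ∩ {o ↔ {a,t}} ∩ {o ↮ c}` splits as the disjoint union of `D_a ∩ E_a ∩ {a~o}` (`o` rides on `a`, `t` elsewhere)
and `R_t ∩ {t~o} ∩ E_t` (`o` rides on `t`). [folklore] -/
theorem muo_split (c a t o : V) (𝒰 : Set (Set V)) :
    ({ω : BondConfig V | {v | (openGraph ω).Reachable o v} ∈ 𝒰} ∩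
        ({ω | (openGraph ω).Reachable o a ∨ (openGraph ω).Reachable o t} ∩ {ω | ¬ (openGraph ω).Reachable o c})) =
      ({ω : BondConfig V | ¬ (openGraph ω).Reachable a t ∧ ¬ (openGraph ω).Reachable a c} ∩
          ({ω | {v | (openGraph ω).Reachable a v} ∈ 𝒰} ∩ {ω | (openGraph ω).Reachable a o})) ∪
        ({ω : BondConfig V | ¬ (openGraph ω).Reachable t c} ∩
          ({ω | (openGraph ω).Reachable t o} ∩ {ω | {v | (openGraph ω).Reachable t v} ∈ 𝒰})) := by
  ext ω
  simp only [Set.mem_inter_iff, Set.mem_setOf_eq, Set.mem_union]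
  constructor
  · rintro ⟨hU, hoat, hoc⟩
    by_cases hto : (openGraph ω).Reachable t o
    · right
      have hset : {v | (openGraph ω).Reachable t v} = {v | (openGraph ω).Reachable o v} := by
        ext v; exact ⟨fun h => hto.symm.trans h, fun h => hto.trans h⟩
      refine ⟨fun htc => hoc (hto.symm.trans htc), hto, ?_⟩
      rw [hset]; exact hU
    · left
      have hoa : (openGraph ω).Reachable o a := by
        rcases hoat with h | h
        · exact h
        · exact absurd h.symm hto
      have hset : {v | (openGraph ω).Reachable a v} = {v | (openGraph ω).Reachable o v} := by
        ext v; exact ⟨fun h => hoa.trans h, fun h => hoa.symm.trans h⟩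
      refine ⟨⟨fun hat => hto ((hoa.trans hat).symm), fun hac => hoc (hoa.trans hac)⟩, ?_, hoa.symm⟩
      rw [hset]; exact hU
  · rintro (⟨⟨hat, hac⟩, hU, hao⟩ | ⟨htc, hto, hU⟩)
    · have hset : {v | (openGraph ω).Reachable o v} = {v | (openGraph ω).Reachable a v} := by
        ext v; exact ⟨fun h => hao.trans h, fun h => hao.symm.trans h⟩
      refine ⟨?_, Or.inl hao.symm, fun hoc => hac (hao.trans hoc)⟩
      rw [hset]; exact hU
    · have hset : {v | (openGraph ω).Reachable o v} = {v | (openGraph ω).Reachable t v} := by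
        ext v; exact ⟨fun h => hto.trans h, fun h => hto.symm.trans h⟩
      refine ⟨?_, Or.inr hto.symm, fun hoc => htc (hto.trans hoc)⟩
      rw [hset]; exact hU

/-- `{C_a ∈ 𝒰} ∩ {a ↮ c}` splits as `D_a ∩ E_a` (`t ∉ C_a`) plus `R_t ∩ {t~a} ∩ E_t` (`t ∈ C_a`, then `C_a = C_t`).
[folklore] -/
theorem nua_split (c a t : V) (𝒰 : Set (Set V)) :
    ({ω : BondConfig V | {v | (openGraph ω).Reachable a v} ∈ 𝒰} ∩ {ω | ¬ (openGraph ω).Reachable a c}) =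
      ({ω : BondConfig V | ¬ (openGraph ω).Reachable a t ∧ ¬ (openGraph ω).Reachable a c} ∩
          {ω | {v | (openGraph ω).Reachable a v} ∈ 𝒰}) ∪
        ({ω : BondConfig V | ¬ (openGraph ω).Reachable t c} ∩
          ({ω | (openGraph ω).Reachable t a} ∩ {ω | {v | (openGraph ω).Reachable t v} ∈ 𝒰})) := by
  ext ω
  simp only [Set.mem_inter_iff, Set.mem_setOf_eq, Set.mem_union]
  constructor
  · rintro ⟨hU, hac⟩
    by_cases hat : (openGraph ω).Reachable a t
    · right
      have hset : {v | (openGraph ω).Reachable t v} = {v | (openGraph ω).Reachable a v} := by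
        ext v; exact ⟨fun h => hat.trans h, fun h => hat.symm.trans h⟩
      refine ⟨fun htc => hac (hat.trans htc), hat.symm, ?_⟩
      rw [hset]; exact hU
    · exact Or.inl ⟨⟨hat, hac⟩, hU⟩
  · rintro (⟨⟨-, hac⟩, hU⟩ | ⟨htc, hta, hU⟩)
    · exact ⟨hU, hac⟩
    · have hset : {v | (openGraph ω).Reachable a v} = {v | (openGraph ω).Reachable t v} := by
        ext v; exact ⟨fun h => hta.trans h, fun h => hta.symm.trans h⟩
      refine ⟨?_, fun hac => htc (hta.trans hac)⟩
      rw [hset]; exact hU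

variable [Fintype V]

/-- **BHK, source `{a}`, sinks `{t} ∪ {c}`**: `μ(D ∩ E_a)·μ(D ∩ {a~o}) ≤ μ(D)·μ(D ∩ E_a ∩ {a~o})`, `D = {a↮t} ∩ {a↮c}`,
`E_a = {C_a ∈ 𝒰}` (`𝒰` an up-family). [cite: VandenbergHaggstromKahn2005, Thm. 1.2 (p. 5)] -/
theorem bhk_a_upfamily (w : Sym2 V → unitInterval) (o c a t : V) (𝒰 : Set (Set V))
    (hU : ∀ W ∈ 𝒰, ∀ W' : Set V, W ⊆ W' → W' ∈ 𝒰) :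
    (prodBernoulli w).real ({ω : BondConfig V | ¬ (openGraph ω).Reachable a t ∧ ¬ (openGraph ω).Reachable a c} ∩
        {ω | {v | (openGraph ω).Reachable a v} ∈ 𝒰}) *
      (prodBernoulli w).real ({ω : BondConfig V | ¬ (openGraph ω).Reachable a t ∧ ¬ (openGraph ω).Reachable a c} ∩
        {ω | (openGraph ω).Reachable a o}) ≤
    (prodBernoulli w).real {ω : BondConfig V | ¬ (openGraph ω).Reachable a t ∧ ¬ (openGraph ω).Reachable a c} *
      (prodBernoulli w).real ({ω : BondConfig V | ¬ (openGraph ω).Reachable a t ∧ ¬ (openGraph ω).Reachable a c} ∩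
        ({ω | {v | (openGraph ω).Reachable a v} ∈ 𝒰} ∩ {ω | (openGraph ω).Reachable a o})) := by
  have ha : a ∈ ({a} : Set V) := by simp
  have key := KNSep.bhk_set_event_pos w ({a} : Set V) (({t} : Set V) ∪ {c})
    (fun C _ => {v | (openGraph C).Reachable a v} ∈ 𝒰)
    (fun C _ => (openGraph C).Reachable a o)
    (fun D C C' hCC' h => hU _ h _ (fun v hv => SimpleGraph.Reachable.mono (openGraph_mono hCC') hv))
    (fun C D D' hDD' h => h)
    (fun D C C' hCC' h => h.mono (openGraph_mono hCC'))
    (fun C D D' hDD' h => h)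
  have hP : {ω : BondConfig V | {v | (openGraph (⋃ s ∈ ({a} : Set V), openEdgeCluster ω s)).Reachable a v} ∈ 𝒰} =
      {ω | {v | (openGraph ω).Reachable a v} ∈ 𝒰} := by
    ext ω
    have : {v | (openGraph (⋃ s ∈ ({a} : Set V), openEdgeCluster ω s)).Reachable a v} =
        {v | (openGraph ω).Reachable a v} := by
      ext v; exact (KNSep.reachable_iff_cluster ω ({a} : Set V) ha v).symm
    simp only [Set.mem_setOf_eq, this]
  have hQ : {ω : BondConfig V | (openGraph (⋃ s ∈ ({a} : Set V), openEdgeCluster ω s)).Reachable a o} =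
      {ω | (openGraph ω).Reachable a o} := by
    ext ω; exact (KNSep.reachable_iff_cluster ω ({a} : Set V) ha o).symm
  rw [sep_single_eq t a c] at key
  simp only [hP, hQ] at key
  exact key

/-- **BHK, source `{t}`, sink `{c}`: `Cov_Q(1{a ∈ C_t}, 1{C_t ∈ 𝒰}) ≥ 0`**, denominator-free:
`μ(R ∩ {t~a})·μ(R ∩ E) ≤ μ(R)·μ(R ∩ {t~a} ∩ E)`, `R = {t ↮ c}`. [cite: VandenbergHaggstromKahn2005, Thm. 1.2 (p. 5)] -/
theorem bhk_t_conn_upfamily (w : Sym2 V → unitInterval) (c a t : V) (𝒰 : Set (Set V))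
    (hU : ∀ W ∈ 𝒰, ∀ W' : Set V, W ⊆ W' → W' ∈ 𝒰) :
    (prodBernoulli w).real ({ω : BondConfig V | ¬ (openGraph ω).Reachable t c} ∩ {ω | (openGraph ω).Reachable t a}) *
      (prodBernoulli w).real ({ω : BondConfig V | ¬ (openGraph ω).Reachable t c} ∩
        {ω | {v | (openGraph ω).Reachable t v} ∈ 𝒰}) ≤
    (prodBernoulli w).real {ω : BondConfig V | ¬ (openGraph ω).Reachable t c} *
      (prodBernoulli w).real ({ω : BondConfig V | ¬ (openGraph ω).Reachable t c} ∩
        ({ω | (openGraph ω).Reachable t a} ∩ {ω | {v | (openGraph ω).Reachable t v} ∈ 𝒰})) := by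
  have ht : t ∈ ({t} : Set V) := by simp
  have key := KNSep.bhk_set_event_pos w ({t} : Set V) ({c} : Set V)
    (fun C _ => (openGraph C).Reachable t a)
    (fun C _ => {v | (openGraph C).Reachable t v} ∈ 𝒰)
    (fun D C C' hCC' h => h.mono (openGraph_mono hCC'))
    (fun C D D' hDD' h => h)
    (fun D C C' hCC' h => hU _ h _ (fun v hv => SimpleGraph.Reachable.mono (openGraph_mono hCC') hv))
    (fun C D D' hDD' h => h)
  have hP : {ω : BondConfig V | (openGraph (⋃ s ∈ ({t} : Set V), openEdgeCluster ω s)).Reachable t a} =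
      {ω | (openGraph ω).Reachable t a} := by
    ext ω; exact (KNSep.reachable_iff_cluster ω ({t} : Set V) ht a).symm
  have hQ : {ω : BondConfig V | {v | (openGraph (⋃ s ∈ ({t} : Set V), openEdgeCluster ω s)).Reachable t v} ∈ 𝒰} =
      {ω | {v | (openGraph ω).Reachable t v} ∈ 𝒰} := by
    ext ω
    have : {v | (openGraph (⋃ s ∈ ({t} : Set V), openEdgeCluster ω s)).Reachable t v} =
        {v | (openGraph ω).Reachable t v} := by
      ext v; exact (KNSep.reachable_iff_cluster ω ({t} : Set V) ht v).symm
    simp only [Set.mem_setOf_eq, this]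
  rw [sep_singletons_eq t c] at key
  simp only [hP, hQ] at key
  exact key

/-- **Weakening the constant in (II).**  With `R = {t↮c}`, `O = {t~o}`, `A = {t~a}`, `E = {C_t ∈ 𝒰}`: the inequality
`μ(R∩O)μ(R∩E)·d + n·μ(R∩A∩E)μ(R) ≤ μ(R∩O∩E)μ(R)·d + n·μ(R∩A)μ(R∩E)` ("(II) with constant `n/d`") implies the same
with any `(n', d')` with `n'·d ≤ n·d'`, `0 < d`, `0 ≤ d'` — because `Cov_Q(1_A, 1_E) ≥ 0` (BHK).
[cite: VandenbergHaggstromKahn2005, Thm. 1.2 (p. 5)] -/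
theorem tilt_weaken (w : Sym2 V → unitInterval) (o c a t : V) (𝒰 : Set (Set V))
    (hU : ∀ W ∈ 𝒰, ∀ W' : Set V, W ⊆ W' → W' ∈ 𝒰) {n d n' d' : ℝ} (hd : 0 < d) (hd' : 0 ≤ d')
    (hnd : n' * d ≤ n * d')
    (h2 : (prodBernoulli w).real ({ω : BondConfig V | ¬ (openGraph ω).Reachable t c} ∩ {ω | (openGraph ω).Reachable t o}) *
          (prodBernoulli w).real ({ω : BondConfig V | ¬ (openGraph ω).Reachable t c} ∩
            {ω | {v | (openGraph ω).Reachable t v} ∈ 𝒰}) * d +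
        n * (prodBernoulli w).real ({ω : BondConfig V | ¬ (openGraph ω).Reachable t c} ∩
            ({ω | (openGraph ω).Reachable t a} ∩ {ω | {v | (openGraph ω).Reachable t v} ∈ 𝒰})) *
          (prodBernoulli w).real {ω : BondConfig V | ¬ (openGraph ω).Reachable t c} ≤
      (prodBernoulli w).real ({ω : BondConfig V | ¬ (openGraph ω).Reachable t c} ∩
            ({ω | (openGraph ω).Reachable t o} ∩ {ω | {v | (openGraph ω).Reachable t v} ∈ 𝒰})) *
          (prodBernoulli w).real {ω : BondConfig V | ¬ (openGraph ω).Reachable t c} * d +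
        n * (prodBernoulli w).real ({ω : BondConfig V | ¬ (openGraph ω).Reachable t c} ∩ {ω | (openGraph ω).Reachable t a}) *
          (prodBernoulli w).real ({ω : BondConfig V | ¬ (openGraph ω).Reachable t c} ∩
            {ω | {v | (openGraph ω).Reachable t v} ∈ 𝒰})) :
    (prodBernoulli w).real ({ω : BondConfig V | ¬ (openGraph ω).Reachable t c} ∩ {ω | (openGraph ω).Reachable t o}) *
          (prodBernoulli w).real ({ω : BondConfig V | ¬ (openGraph ω).Reachable t c} ∩
            {ω | {v | (openGraph ω).Reachable t v} ∈ 𝒰}) * d' +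
        n' * (prodBernoulli w).real ({ω : BondConfig V | ¬ (openGraph ω).Reachable t c} ∩
            ({ω | (openGraph ω).Reachable t a} ∩ {ω | {v | (openGraph ω).Reachable t v} ∈ 𝒰})) *
          (prodBernoulli w).real {ω : BondConfig V | ¬ (openGraph ω).Reachable t c} ≤
      (prodBernoulli w).real ({ω : BondConfig V | ¬ (openGraph ω).Reachable t c} ∩
            ({ω | (openGraph ω).Reachable t o} ∩ {ω | {v | (openGraph ω).Reachable t v} ∈ 𝒰})) *
          (prodBernoulli w).real {ω : BondConfig V | ¬ (openGraph ω).Reachable t c} * d' +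
        n' * (prodBernoulli w).real ({ω : BondConfig V | ¬ (openGraph ω).Reachable t c} ∩ {ω | (openGraph ω).Reachable t a}) *
          (prodBernoulli w).real ({ω : BondConfig V | ¬ (openGraph ω).Reachable t c} ∩
            {ω | {v | (openGraph ω).Reachable t v} ∈ 𝒰}) := by
  have hcov := bhk_t_conn_upfamily w c a t 𝒰 hU
  set μ := prodBernoulli w with hμ
  set R : Set (BondConfig V) := {ω | ¬ (openGraph ω).Reachable t c} with hR
  set O : Set (BondConfig V) := {ω | (openGraph ω).Reachable t o} with hO
  set A : Set (BondConfig V) := {ω | (openGraph ω).Reachable t a} with hA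
  set E : Set (BondConfig V) := {ω | {v | (openGraph ω).Reachable t v} ∈ 𝒰} with hE
  -- X := μ(R∩(O∩E))μ(R) - μ(R∩O)μ(R∩E),  C := μ(R∩(A∩E))μ(R) - μ(R∩A)μ(R∩E) ≥ 0 ;  h2 : n C ≤ d X ; want n' C ≤ d' X
  have hC : 0 ≤ μ.real (R ∩ (A ∩ E)) * μ.real R - μ.real (R ∩ A) * μ.real (R ∩ E) := by nlinarith [hcov]
  have hX : n * (μ.real (R ∩ (A ∩ E)) * μ.real R - μ.real (R ∩ A) * μ.real (R ∩ E)) ≤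
      d * (μ.real (R ∩ (O ∩ E)) * μ.real R - μ.real (R ∩ O) * μ.real (R ∩ E)) := by nlinarith [h2]
  -- d' (d X) ≥ d' n C ≥ n' d C, divide by d
  have h3 : d * (n' * (μ.real (R ∩ (A ∩ E)) * μ.real R - μ.real (R ∩ A) * μ.real (R ∩ E))) ≤
      d * (d' * (μ.real (R ∩ (O ∩ E)) * μ.real R - μ.real (R ∩ O) * μ.real (R ∩ E))) := by
    nlinarith [mul_le_mul_of_nonneg_left hX hd', mul_le_mul_of_nonneg_right hnd hC]
  have h4 := le_of_mul_le_mul_left h3 hd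
  nlinarith [h4]

/-- **The bridge: (II) ⟹ cluster domination at the box endpoint `λ_a = κ_a`** (MEMO-gen26 §2, denominator-free).
With `R = {t↮c}`, `D = {a↮t} ∩ {a↮c}`, `E_t = {C_t ∈ 𝒰}`, `E_a = {C_a ∈ 𝒰}` (`𝒰` any up-family of vertex sets),
`μ_o(𝒰) = μ({C_o ∈ 𝒰} ∩ {o ↔ {a,t}} ∩ {o↮c})`, `ν_a(𝒰) = μ(E_a ∩ {a↮c})`, `ν_t(𝒰) = μ(R ∩ E_t)`: IF (II) holds for
`(s,x,o,a) := (t,c,o,a)` and `E_t` with the constant `κ_a = μ(D ∩ {a~o})/μ(D)`, i.e.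
`μ(R∩O)μ(R∩E_t)μ(D) + μ(D∩{a~o})μ(R∩A∩E_t)μ(R) ≤ μ(R∩O∩E_t)μ(R)μ(D) + μ(D∩{a~o})μ(R∩A)μ(R∩E_t)` (`O = {t~o}`,
`A = {t~a}`), THEN
`μ_o(𝒰)·μ(D)·μ(R) ≥ μ(D∩{a~o})·μ(R)·ν_a(𝒰) + [μ(R∩O)μ(D) − μ(D∩{a~o})μ(R∩A)]·ν_t(𝒰)`,
i.e. `μ_o(𝒰) ≥ κ_a ν_a(𝒰) + λ_t ν_t(𝒰)` with `λ_t = Q(t~o) − κ_a Q(t~a)`, `Q = μ(·|t↮c)`.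
[cite: KozmaNitzan2024, §2.2 Lemmas 1–2 (pp. 5–6), §3 (pp. 7–12)] [cite: VandenbergHaggstromKahn2005, Thm. 1.2 (p. 5)] -/
theorem dominance_endpoint_of_tilt (w : Sym2 V → unitInterval) (o c a t : V) (𝒰 : Set (Set V))
    (hU : ∀ W ∈ 𝒰, ∀ W' : Set V, W ⊆ W' → W' ∈ 𝒰)
    (h2 : (prodBernoulli w).real ({ω : BondConfig V | ¬ (openGraph ω).Reachable t c} ∩ {ω | (openGraph ω).Reachable t o}) *
          (prodBernoulli w).real ({ω : BondConfig V | ¬ (openGraph ω).Reachable t c} ∩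
            {ω | {v | (openGraph ω).Reachable t v} ∈ 𝒰}) *
          (prodBernoulli w).real {ω : BondConfig V | ¬ (openGraph ω).Reachable a t ∧ ¬ (openGraph ω).Reachable a c} +
        (prodBernoulli w).real ({ω : BondConfig V | ¬ (openGraph ω).Reachable a t ∧ ¬ (openGraph ω).Reachable a c} ∩
            {ω | (openGraph ω).Reachable a o}) *
          (prodBernoulli w).real ({ω : BondConfig V | ¬ (openGraph ω).Reachable t c} ∩
            ({ω | (openGraph ω).Reachable t a} ∩ {ω | {v | (openGraph ω).Reachable t v} ∈ 𝒰})) *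
          (prodBernoulli w).real {ω : BondConfig V | ¬ (openGraph ω).Reachable t c} ≤
      (prodBernoulli w).real ({ω : BondConfig V | ¬ (openGraph ω).Reachable t c} ∩
            ({ω | (openGraph ω).Reachable t o} ∩ {ω | {v | (openGraph ω).Reachable t v} ∈ 𝒰})) *
          (prodBernoulli w).real {ω : BondConfig V | ¬ (openGraph ω).Reachable t c} *
          (prodBernoulli w).real {ω : BondConfig V | ¬ (openGraph ω).Reachable a t ∧ ¬ (openGraph ω).Reachable a c} +
        (prodBernoulli w).real ({ω : BondConfig V | ¬ (openGraph ω).Reachable a t ∧ ¬ (openGraph ω).Reachable a c} ∩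
            {ω | (openGraph ω).Reachable a o}) *
          (prodBernoulli w).real ({ω : BondConfig V | ¬ (openGraph ω).Reachable t c} ∩ {ω | (openGraph ω).Reachable t a}) *
          (prodBernoulli w).real ({ω : BondConfig V | ¬ (openGraph ω).Reachable t c} ∩
            {ω | {v | (openGraph ω).Reachable t v} ∈ 𝒰})) :
    (prodBernoulli w).real ({ω : BondConfig V | ¬ (openGraph ω).Reachable a t ∧ ¬ (openGraph ω).Reachable a c} ∩
          {ω | (openGraph ω).Reachable a o}) *
        (prodBernoulli w).real {ω : BondConfig V | ¬ (openGraph ω).Reachable t c} *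
        (prodBernoulli w).real ({ω : BondConfig V | {v | (openGraph ω).Reachable a v} ∈ 𝒰} ∩
          {ω | ¬ (openGraph ω).Reachable a c}) +
      ((prodBernoulli w).real ({ω : BondConfig V | ¬ (openGraph ω).Reachable t c} ∩ {ω | (openGraph ω).Reachable t o}) *
          (prodBernoulli w).real {ω : BondConfig V | ¬ (openGraph ω).Reachable a t ∧ ¬ (openGraph ω).Reachable a c} -
        (prodBernoulli w).real ({ω : BondConfig V | ¬ (openGraph ω).Reachable a t ∧ ¬ (openGraph ω).Reachable a c} ∩
            {ω | (openGraph ω).Reachable a o}) *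
          (prodBernoulli w).real ({ω : BondConfig V | ¬ (openGraph ω).Reachable t c} ∩ {ω | (openGraph ω).Reachable t a})) *
        (prodBernoulli w).real ({ω : BondConfig V | ¬ (openGraph ω).Reachable t c} ∩
          {ω | {v | (openGraph ω).Reachable t v} ∈ 𝒰}) ≤
    (prodBernoulli w).real ({ω : BondConfig V | {v | (openGraph ω).Reachable o v} ∈ 𝒰} ∩
          ({ω | (openGraph ω).Reachable o a ∨ (openGraph ω).Reachable o t} ∩ {ω | ¬ (openGraph ω).Reachable o c})) *
        (prodBernoulli w).real {ω : BondConfig V | ¬ (openGraph ω).Reachable a t ∧ ¬ (openGraph ω).Reachable a c} *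
        (prodBernoulli w).real {ω : BondConfig V | ¬ (openGraph ω).Reachable t c} := by
  have hbhk := bhk_a_upfamily w o c a t 𝒰 hU
  set μ := prodBernoulli w with hμ
  set R : Set (BondConfig V) := {ω | ¬ (openGraph ω).Reachable t c} with hR
  set D : Set (BondConfig V) := {ω | ¬ (openGraph ω).Reachable a t ∧ ¬ (openGraph ω).Reachable a c} with hD
  set O : Set (BondConfig V) := {ω | (openGraph ω).Reachable t o} with hO
  set A : Set (BondConfig V) := {ω | (openGraph ω).Reachable t a} with hA
  set Et : Set (BondConfig V) := {ω | {v | (openGraph ω).Reachable t v} ∈ 𝒰} with hEt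
  set Ea : Set (BondConfig V) := {ω | {v | (openGraph ω).Reachable a v} ∈ 𝒰} with hEa
  set Oa : Set (BondConfig V) := {ω | (openGraph ω).Reachable a o} with hOa
  -- the two splits
  have hmo : μ.real ({ω : BondConfig V | {v | (openGraph ω).Reachable o v} ∈ 𝒰} ∩
        ({ω | (openGraph ω).Reachable o a ∨ (openGraph ω).Reachable o t} ∩ {ω | ¬ (openGraph ω).Reachable o c})) =
      μ.real (D ∩ (Ea ∩ Oa)) + μ.real (R ∩ (O ∩ Et)) := by
    rw [muo_split c a t o 𝒰]
    apply measureReal_union _ MeasurableSet.of_discrete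
    rw [Set.disjoint_left]
    rintro ω ⟨⟨hat, -⟩, -, hao⟩ ⟨-, hto, -⟩
    exact hat (hao.trans hto.symm)
  have hna : μ.real ({ω : BondConfig V | {v | (openGraph ω).Reachable a v} ∈ 𝒰} ∩ {ω | ¬ (openGraph ω).Reachable a c}) =
      μ.real (D ∩ Ea) + μ.real (R ∩ (A ∩ Et)) := by
    rw [nua_split c a t 𝒰]
    apply measureReal_union _ MeasurableSet.of_discrete
    rw [Set.disjoint_left]
    rintro ω ⟨⟨hat, -⟩, -⟩ ⟨-, hta, -⟩
    exact hat hta.symm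
  rw [hmo, hna]
  have hr : 0 ≤ μ.real R := measureReal_nonneg
  nlinarith [mul_le_mul_of_nonneg_left hbhk hr, h2]

end KNGoodTwoMark

end Summit.CriticalPhenomena.PercolationContinuityZ3.Theorems
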